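import Mathlib
import Summits.MatrixMultiplication.MatrixMultiplication.Theorems.SubgroupIdentityDesigns.Negative.LinearCharacterLevel

/-!
# The pentagon obstruction: the triangle criterion for identity-test levels is not sharp
(negative lemma, crux `SubgroupIdentityDesigns`, stmt-MatrixMultiplication-14079; cell B2b-5, gen 4)

`Negative.PatternTriangle` shows: a transposed `(k+1)`-triangle inside the position set of a pattern group forces the
identity-test level above `k`.  A census of all bipartite position sets up to `5 × 5` (gen-4 report ORACLE-g4 §G4-2)
found exactly five classes with triangle number `2` whose level-`2` identity test still fails; the smallest,
`E1 = {(0,0),(1,1),(2,0),(2,2),(3,0),(3,1),(3,3),(4,1),(4,2),(4,4)}` (ten positions), is a PENTAGON: its off-diagonal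
positions `{2,0},{3,0},{3,1},{4,1},{4,2}` are the edges of a `5`-cycle `0–2–4–1–3–0`, and the bad specification
"diagonal `= 1`, the five others `= 0`" is a one-directional version of Haemers' minimum-rank problem for `C₅`
(min-rank `3` over every field).  This file kernel-checks that obstruction, uniformly in the prime `p`:

* `three_le_rank_of_pentagonEntries` — over ANY field: a `5 × 5` matrix with unit diagonal and zeros at
  `(2,0),(3,0),(3,1),(4,1),(4,2)` has rank `≥ 3`.  Proof: if the rows span a plane, rows `2,3` (zero in column `0`,
  where row `0` is not) must be parallel, rows `3,4` likewise (column `1`); then column `2` reads `1 = a·B₃₂` and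
  `0 = b·B₃₂` with `a, b ≠ 0`. [folklore linear algebra; cf. Haemers' bound for the pentagon]
* `gridCoset_entry` — on the affine dual coset of the grid form `λ(n) = Σ_l n_{γ l, ρ l}` every specified position
  `(γ j, ρ i) ∈ Pos` pins `M_{ρ i, γ j} = [i = j]` (the entry computation of `succ_le_rank_of_triCoset`, isolated).
* `three_le_rank_of_pentagonCoset` / `no_idTest_of_patPentagon` — a position set containing the transposed pentagon
  `{(γ i, ρ i)} ∪ {(γ 0, ρ 2), (γ 0, ρ 3), (γ 1, ρ 3), (γ 1, ρ 4), (γ 2, ρ 4)}` admits no level-`2` identity test.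
* `no_levelK_design_of_pattern` — the crux-language wrapper, once and for all: any "no identity test on sets
  containing the pattern points" lemma becomes "no level-`k` identity design for `(H₁, H₂, H₃)` once `H₁` contains the
  pattern unipotents".
* `no_levelTwo_design_of_patPentagon` — hence: `H₁ ⊇` the unipotents of a strictly-lower position set containing a
  transposed pentagon ⇒ no level-`2` identity design, for all `H₂, H₃` and every prime `p` — although such a position
  set (e.g. `E1` itself, an abelian group of order `p^{10}` in `GL_{10}(𝔽_p)`) need not contain any transposed
  `3`-triangle, nor (ORACLE-g4) any rank-one triangular configuration of size `3`.
So the identity-test level of a pattern group is not the triangle number in general (it is a finite-field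
max-min-rank invariant, `p`-dependent in other examples).  Sorry-free; standard axioms.
VALUE = theorem (a certified non-sharpness witness / design-search filter), NOT summit progress.
-/

set_option linter.dupNamespace false

noncomputable section

open scoped BigOperators Classical

namespace Summit.MatrixMultiplication.MatrixMultiplication.Theorems.SubgroupIdentityDesigns.Negative

variable {p m : ℕ} [Fact p.Prime]

/-- **PENTAGON RANK BOUND (any field).**  Unit diagonal and zeros at `(2,0),(3,0),(3,1),(4,1),(4,2)` force rank
`≥ 3`. -/
theorem three_le_rank_of_pentagonEntries {K : Type*} [Field K] (B : Matrix (Fin 5) (Fin 5) K)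
    (hd : ∀ i, B i i = 1) (h20 : B 2 0 = 0) (h30 : B 3 0 = 0) (h31 : B 3 1 = 0)
    (h41 : B 4 1 = 0) (h42 : B 4 2 = 0) : 3 ≤ B.rank := by
  by_contra hlt
  have hrk : B.rank ≤ 2 := by omega
  have hfin : Module.finrank K (Submodule.span K (Set.range B.row)) ≤ 2 := by
    rw [← Matrix.rank_eq_finrank_span_row]
    exact hrk
  have hrow : ∀ c : Fin 5, B c ∈ Submodule.span K (Set.range B.row) :=
    fun c => Submodule.subset_span ⟨c, rfl⟩
  -- two rows vanishing in a column where a third row does not cannot be independent (else they span all rows)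
  have key : ∀ a b c : Fin 5, ∀ j : Fin 5, B a j = 0 → B b j = 0 → B c j ≠ 0 →
      ¬ LinearIndependent K ![B a, B b] := by
    intro a b c j ha hb hc hind
    have h2 : Module.finrank K (Submodule.span K (Set.range ![B a, B b])) = 2 := by
      rw [finrank_span_eq_card hind, Fintype.card_fin]
    have hle : Submodule.span K (Set.range ![B a, B b]) ≤ Submodule.span K (Set.range B.row) := by
      refine Submodule.span_le.2 ?_
      rintro _ ⟨i, rfl⟩
      fin_cases i
      · simpa using hrow a
      · simpa using hrow b
    have heq : Submodule.span K (Set.range ![B a, B b]) = Submodule.span K (Set.range B.row) :=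
      Submodule.eq_of_le_of_finrank_le hle (by rw [h2]; exact hfin)
    have hcmem : B c ∈ Submodule.span K (Set.range ![B a, B b]) := by
      rw [heq]
      exact hrow c
    obtain ⟨f, hf⟩ := (Submodule.mem_span_range_iff_exists_fun K).1 hcmem
    have hj := congrFun hf j
    simp [Fin.sum_univ_two, ha, hb] at hj
    exact hc hj.symm
  have hne : ∀ i : Fin 5, B i ≠ 0 := fun i h => by
    have := congrFun h i
    rw [hd i] at this
    exact one_ne_zero this
  have h23 : ∃ a : K, a • B 2 = B 3 := by
    have := key 2 3 0 0 h20 h30 (by rw [hd 0]; exact one_ne_zero)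
    rw [LinearIndependent.pair_iff' (hne 2)] at this
    push Not at this
    exact this
  have h34 : ∃ b : K, b • B 3 = B 4 := by
    have := key 3 4 1 1 h31 h41 (by rw [hd 1]; exact one_ne_zero)
    rw [LinearIndependent.pair_iff' (hne 3)] at this
    push Not at this
    exact this
  obtain ⟨a, ha⟩ := h23
  obtain ⟨b, hb⟩ := h34
  have ha3 : a * B 2 3 = 1 := by
    have := congrFun ha 3
    simpa [hd 3] using this
  have ha2 : a * B 2 2 = B 3 2 := by
    have := congrFun ha 2
    simpa using this
  have hb2 : b * B 3 2 = B 4 2 := by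
    have := congrFun hb 2
    simpa using this
  have hb4 : b * B 3 4 = 1 := by
    have := congrFun hb 4
    simpa [hd 4] using this
  rw [hd 2, mul_one] at ha2
  rw [h42, ← ha2] at hb2
  have ha0 : a ≠ 0 := by
    rintro rfl
    simp at ha3
  have hb0 : b ≠ 0 := by
    rintro rfl
    simp at hb4
  exact mul_ne_zero hb0 ha0 hb2

/-- On the affine dual coset of the grid form, every position `(γ j, ρ i) ∈ Pos` pins the entry
`M_{ρ i, γ j} = [i = j]`. -/
theorem gridCoset_entry {k : ℕ} (Pos : Finset (Fin m × Fin m)) (ρ γ : Fin (k + 1) → Fin m)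
    (hρ : Function.Injective ρ) (hγ : Function.Injective γ) (M : CMat p m)
    (hM : ∀ e : CMat p m,
      Matrix.trace (M * (Matrix.of fun a b => if (a, b) ∈ Pos then e a b else 0)) =
        ∑ l : Fin (k + 1), (Matrix.of fun a b => if (a, b) ∈ Pos then e a b else 0 : CMat p m) (γ l) (ρ l))
    (i j : Fin (k + 1)) (hij : (γ j, ρ i) ∈ Pos) : M (ρ i) (γ j) = if i = j then 1 else 0 := by
  have h := hM (Matrix.of fun a b => if a = γ j ∧ b = ρ i then (1 : ZMod p) else 0)
  have hT : (Matrix.of fun a b => if (a, b) ∈ Pos then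
      (Matrix.of fun a b => if a = γ j ∧ b = ρ i then (1 : ZMod p) else 0 : CMat p m) a b else 0 : CMat p m) =
      Matrix.of fun a b => if a = γ j ∧ b = ρ i then (1 : ZMod p) else 0 := by
    ext a b
    simp only [Matrix.of_apply]
    by_cases hab : a = γ j ∧ b = ρ i
    · obtain ⟨rfl, rfl⟩ := hab
      rw [if_pos hij]
    · rw [if_neg hab]
      split_ifs <;> rfl
  rw [hT, trace_mul_elem, gridForm_elem ρ γ hρ hγ] at h
  exact h

/-- **PENTAGON COSET.**  A position set containing the transposed pentagon pins, on the affine dual coset of the grid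
form on `Fin 5`, a unit diagonal and the five pentagon zeros of `M.submatrix ρ γ`; hence rank `≥ 3`. -/
theorem three_le_rank_of_pentagonCoset (Pos : Finset (Fin m × Fin m)) (ρ γ : Fin 5 → Fin m)
    (hρ : Function.Injective ρ) (hγ : Function.Injective γ) (hdiag : ∀ i, (γ i, ρ i) ∈ Pos)
    (h20 : (γ 0, ρ 2) ∈ Pos) (h30 : (γ 0, ρ 3) ∈ Pos) (h31 : (γ 1, ρ 3) ∈ Pos) (h41 : (γ 1, ρ 4) ∈ Pos)
    (h42 : (γ 2, ρ 4) ∈ Pos) (M : CMat p m)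
    (hM : ∀ e : CMat p m,
      Matrix.trace (M * (Matrix.of fun a b => if (a, b) ∈ Pos then e a b else 0)) =
        ∑ l : Fin 5, (Matrix.of fun a b => if (a, b) ∈ Pos then e a b else 0 : CMat p m) (γ l) (ρ l)) :
    3 ≤ M.rank := by
  have hent := gridCoset_entry (k := 4) Pos ρ γ hρ hγ M hM
  have hB : 3 ≤ (M.submatrix ρ γ).rank := by
    refine three_le_rank_of_pentagonEntries (M.submatrix ρ γ) ?_ ?_ ?_ ?_ ?_ ?_
    · intro i
      rw [Matrix.submatrix_apply, hent i i (hdiag i), if_pos rfl]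
    · rw [Matrix.submatrix_apply, hent 2 0 h20, if_neg (by decide)]
    · rw [Matrix.submatrix_apply, hent 3 0 h30, if_neg (by decide)]
    · rw [Matrix.submatrix_apply, hent 3 1 h31, if_neg (by decide)]
    · rw [Matrix.submatrix_apply, hent 4 1 h41, if_neg (by decide)]
    · rw [Matrix.submatrix_apply, hent 4 2 h42, if_neg (by decide)]
  exact hB.trans (Matrix.rank_submatrix_le M ρ γ)

/-- **NO LEVEL-2 IDENTITY TEST ON A SET CONTAINING THE PATTERN POINTS OF A TRANSPOSED PENTAGON.** -/
theorem no_idTest_of_patPentagon (Pos : Finset (Fin m × Fin m)) (ρ γ : Fin 5 → Fin m)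
    (hρ : Function.Injective ρ) (hγ : Function.Injective γ) (hdiag : ∀ i, (γ i, ρ i) ∈ Pos)
    (h20 : (γ 0, ρ 2) ∈ Pos) (h30 : (γ 0, ρ 3) ∈ Pos) (h31 : (γ 1, ρ 3) ∈ Pos) (h41 : (γ 1, ρ 4) ∈ Pos)
    (h42 : (γ 2, ρ 4) ∈ Pos) (S : Set (CMat p m))
    (hS : ∀ e : CMat p m, 1 + (Matrix.of fun a b => if (a, b) ∈ Pos then e a b else 0 : CMat p m) ∈ S)
    (c : CMat p m → ℂ) (hc : ∀ M : CMat p m, 2 < M.rank → c M = 0)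
    (h1 : fourierMat c 1 = 1) (h0 : ∀ s ∈ S, s ≠ 1 → fourierMat c s = 0) : False := by
  let T : CMat p m →+ CMat p m := AddMonoidHom.mk'
    (fun e : CMat p m => (Matrix.of fun a b => if (a, b) ∈ Pos then e a b else 0 : CMat p m)) (by
      intro x y
      ext a b
      simp only [Matrix.of_apply, Matrix.add_apply]
      split_ifs <;> simp)
  let lam : CMat p m →+ ZMod p := AddMonoidHom.mk'
    (fun n : CMat p m => ∑ l : Fin 5, n (γ l) (ρ l)) (by
      intro x y
      simp [Finset.sum_add_distrib])
  have hT : ∀ e, T e = (Matrix.of fun a b => if (a, b) ∈ Pos then e a b else 0 : CMat p m) := fun e => rfl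
  have hlam : ∀ n, lam n = ∑ l : Fin 5, n (γ l) (ρ l) := fun n => rfl
  refine no_idTest_of_affineDual 2 T lam ?_ S (fun e => by rw [hT]; exact hS e) c hc h1 h0
  intro M hM
  by_contra hall
  push Not at hall
  have := three_le_rank_of_pentagonCoset Pos ρ γ hρ hγ hdiag h20 h30 h31 h41 h42 M
    (fun e => by rw [← hT, ← hlam]; exact hall e)
  omega

/-- **CRUX-LANGUAGE WRAPPER (once and for all).**  If every unipotent `1 + n_e` of the position set `Pos` is
invertible and lies in `H₁`, then any lemma "no level-`k` identity test on a set containing the pattern points"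
yields "no level-`k` identity design for `(H₁, H₂, H₃)`". -/
theorem no_levelK_design_of_pattern (k : ℕ) (Pos : Finset (Fin m × Fin m))
    (hdet : ∀ e : CMat p m, (1 + (Matrix.of fun a b => if (a, b) ∈ Pos then e a b else 0 : CMat p m)).det ≠ 0)
    (hno : ∀ S : Set (CMat p m),
      (∀ e : CMat p m, 1 + (Matrix.of fun a b => if (a, b) ∈ Pos then e a b else 0 : CMat p m) ∈ S) →
      ∀ c : CMat p m → ℂ, (∀ M : CMat p m, k < M.rank → c M = 0) → fourierMat c 1 = 1 →
        (∀ s ∈ S, s ≠ 1 → fourierMat c s = 0) → False)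
    {H₁ H₂ H₃ : Subgroup (Matrix.GeneralLinearGroup (Fin m) (ZMod p))}
    (hQ : ∀ u : Matrix.GeneralLinearGroup (Fin m) (ZMod p),
      (∀ a b : Fin m, ((u : CMat p m) - 1) a b ≠ 0 → (a, b) ∈ Pos) → u ∈ H₁)
    (hid : ∃ c : CMat p m → ℂ, (∀ M : CMat p m, k < M.rank → c M = 0) ∧
      (∑ M : CMat p m, c M * ZMod.stdAddChar (Matrix.trace
        (M * ((1 : Matrix.GeneralLinearGroup (Fin m) (ZMod p)) : CMat p m)))) = 1 ∧
      ∀ a ∈ H₁, ∀ b ∈ H₂, ∀ g ∈ H₃, a * b * g ≠ 1 →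
        (∑ M : CMat p m, c M * ZMod.stdAddChar (Matrix.trace
          (M * ((a * b * g : Matrix.GeneralLinearGroup (Fin m) (ZMod p)) : CMat p m)))) = 0) :
    False := by
  obtain ⟨c, hc, h1, h0⟩ := hid
  let S : Set (CMat p m) := {s | ∃ a ∈ H₁, ∃ b ∈ H₂, ∃ g ∈ H₃,
    s = ((a * b * g : Matrix.GeneralLinearGroup (Fin m) (ZMod p)) : CMat p m)}
  refine hno S ?_ c hc ?_ ?_
  · intro e
    let u : Matrix.GeneralLinearGroup (Fin m) (ZMod p) :=
      Matrix.GeneralLinearGroup.mkOfDetNeZero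
        (1 + (Matrix.of fun a b => if (a, b) ∈ Pos then e a b else 0 : CMat p m)) (hdet e)
    have hu : (u : CMat p m) = 1 + (Matrix.of fun a b => if (a, b) ∈ Pos then e a b else 0 : CMat p m) :=
      rfl
    have huH : u ∈ H₁ := by
      refine hQ u fun a b hab => ?_
      rw [hu, add_sub_cancel_left] at hab
      simp only [Matrix.of_apply] at hab
      by_contra hmem
      exact hab (if_neg hmem)
    refine ⟨u, huH, 1, H₂.one_mem, 1, H₃.one_mem, ?_⟩
    rw [mul_one, mul_one, hu]
  · simpa [fourierMat] using h1
  · rintro s ⟨a, ha, b, hb, g, hg, rfl⟩ hs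
    refine h0 a ha b hb g hg fun h => hs ?_
    rw [h, Matrix.GeneralLinearGroup.coe_one]

/-- **DESIGN FILTER (pentagon).**  In `GL_m(𝔽_p)`: if `H₁` contains every unipotent supported on a strictly-lower
position set `Pos` containing a transposed pentagon (`ρ, γ : Fin 5 → Fin m` injective; the five "diagonal"
positions `(γ i, ρ i)` and `(γ 0, ρ 2), (γ 0, ρ 3), (γ 1, ρ 3), (γ 1, ρ 4), (γ 2, ρ 4)`), then `(H₁, H₂, H₃)` admits NO
level-`2` identity design, whatever `H₂, H₃` and the prime `p` — even when `Pos` contains no transposed `3`-triangle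
(e.g. `Pos` = exactly these ten positions: an abelian subgroup of order `p^{10}`). -/
theorem no_levelTwo_design_of_patPentagon (Pos : Finset (Fin m × Fin m))
    (hlow : ∀ ab ∈ Pos, ab.2.val < ab.1.val) (ρ γ : Fin 5 → Fin m)
    (hρ : Function.Injective ρ) (hγ : Function.Injective γ) (hdiag : ∀ i, (γ i, ρ i) ∈ Pos)
    (h20 : (γ 0, ρ 2) ∈ Pos) (h30 : (γ 0, ρ 3) ∈ Pos) (h31 : (γ 1, ρ 3) ∈ Pos) (h41 : (γ 1, ρ 4) ∈ Pos)
    (h42 : (γ 2, ρ 4) ∈ Pos)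
    {H₁ H₂ H₃ : Subgroup (Matrix.GeneralLinearGroup (Fin m) (ZMod p))}
    (hQ : ∀ u : Matrix.GeneralLinearGroup (Fin m) (ZMod p),
      (∀ a b : Fin m, ((u : CMat p m) - 1) a b ≠ 0 → (a, b) ∈ Pos) → u ∈ H₁)
    (hid : ∃ c : CMat p m → ℂ, (∀ M : CMat p m, 2 < M.rank → c M = 0) ∧
      (∑ M : CMat p m, c M * ZMod.stdAddChar (Matrix.trace
        (M * ((1 : Matrix.GeneralLinearGroup (Fin m) (ZMod p)) : CMat p m)))) = 1 ∧
      ∀ a ∈ H₁, ∀ b ∈ H₂, ∀ g ∈ H₃, a * b * g ≠ 1 →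
        (∑ M : CMat p m, c M * ZMod.stdAddChar (Matrix.trace
          (M * ((a * b * g : Matrix.GeneralLinearGroup (Fin m) (ZMod p)) : CMat p m)))) = 0) :
    False :=
  no_levelK_design_of_pattern 2 Pos (fun e => by rw [det_one_add_patLow Pos hlow]; exact one_ne_zero)
    (fun S hS c hc h1 h0 => no_idTest_of_patPentagon Pos ρ γ hρ hγ hdiag h20 h30 h31 h41 h42 S hS c hc h1 h0)
    hQ hid

end Summit.MatrixMultiplication.MatrixMultiplication.Theorems.SubgroupIdentityDesigns.Negative

end
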